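import Literature.NumberTheory.Sieve.FGKMT2018SieveWeightsStructure
import HarnessLib

/-!
# FGKMT 2018 §8 — the singular series `𝔖_D(𝓛_1)`, `𝔖_D(𝓛_p)`, `𝔖_D(L̃_{q,i})` as honest limits

Second support file for the edge «Theorem 6 ⟹ Theorem 5» (Ford–Green–Konyagin–Maynard–Tao,
*Long gaps between primes*, §8). The typed singular series `singSeriesExcl 𝓛 D` of
`FGKMT2018MultidimensionalSieve.lean` is an ordered `limUnder` of partial products (junk if they
diverge). Here we identify it, for the families of §8 built on an admissible tuple `H`
(`tupleEnum H`), with genuine limits via the convergence theorems of `SingularSeries.lean`: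

* `singSeriesExcl_tupleForms_one`: `𝔖_D(𝓛_1) = 𝔖(H) / ∏_{s ∣ D} f_H(s)` (`D ≥ 1`), positive;
* `singSeriesExcl_tupleForms`: `𝔖_D(𝓛_p) = (f_{𝓛_p}(p)/f_{𝓛_1}(p)) · 𝔖_D(𝓛_1)` for primes `p ∤ D`;
* `singSeriesExcl_wbpForms`: the same for `L̃_{q,i₀}` with the prime `q`;
* `singFactor_div_singFactor_eq`, `one_le_corr_le`: the correction factor is
  `(1 − 1/p)/(1 − k/p) ∈ [1, 1 + 2k/p]` — §8's "`𝔖(𝓛_p) = (1 + O(k/x)) 𝔖` independently of `p`".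

## References
* K. Ford, B. Green, S. Konyagin, J. Maynard, T. Tao, *Long gaps between primes*, J. Amer. Math.
  Soc. 31 (2018), §8 (arXiv:1412.5029v4 pp. 22–24).
* J. Maynard, *Dense clusters of primes in subsets*, Compositio Math. 152 (2016), §7.
* H. Halberstam, H.-E. Richert, *Sieve Methods*, ch. 10 (convergence of the singular series).
-/

open Finset Filter Topology

namespace Literature.NumberTheory.Sieve.FGKMT2018

variable {k : ℕ}

/-! ### `𝔖_D` of `𝓛_1`, `𝓛_p`, `L̃_{q,i₀}` as honest limits (via `SingularSeries.lean`) -/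

/-- The increasing enumeration of a finite `H ⊆ ℤ` with `#H = k`, as a tuple `Fin k → ℤ`.
[cite: FordGreenKonyaginMaynardTao2018, §6] -/
def tupleEnum (H : Finset ℤ) {k : ℕ} (hk : H.card = k) : Fin k → ℤ := fun i => H.orderEmbOfFin hk i

/-- `tupleEnum` is injective. [cite: FordGreenKonyaginMaynardTao2018, §6] -/
theorem tupleEnum_injective (H : Finset ℤ) {k : ℕ} (hk : H.card = k) :
    Function.Injective (tupleEnum H hk) :=
  fun _ _ hij => (H.orderEmbOfFin hk).injective hij

/-- The entries of `tupleEnum H` lie in `H`. [cite: FordGreenKonyaginMaynardTao2018, §6] -/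
theorem tupleEnum_mem (H : Finset ℤ) {k : ℕ} (hk : H.card = k) (i : Fin k) : tupleEnum H hk i ∈ H :=
  Finset.orderEmbOfFin_mem H hk i

/-- `ν_{tupleEnum H} = ν_H`. [cite: FordGreenKonyaginMaynardTao2018, §6] -/
theorem tupleCount_tupleEnum (H : Finset ℤ) {k : ℕ} (hk : H.card = k) (s : ℕ) :
    tupleCount (tupleEnum H hk) s = tupleResidueCount H s :=
  tupleCount_orderEmbOfFin H hk s

/-- The local factor of `𝓛_1 = {n + h_i}` at a prime is the Hardy–Littlewood factor of `H`.
[cite: FordGreenKonyaginMaynardTao2018, §6] -/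
theorem singFactor_tupleForms_one (H : Finset ℤ) {k : ℕ} (hk : H.card = k) {s : ℕ} (hs : s.Prime) :
    singFactor (tupleForms (tupleEnum H hk) 1) s = singularSeriesFactor H s := by
  rw [singFactor_tupleForms _ hs (Nat.Prime.not_dvd_one hs), tupleCount_tupleEnum, singularSeriesFactor, hk]

/-- The finitely many Hardy–Littlewood factors excluded by `𝔖_D`: `∏_{s ∣ D} f_H(s)`.
[cite: Maynard2016DenseClusters, §7 (7.1)] -/
noncomputable def exclProd (H : Finset ℤ) (D : ℕ) : ℝ := ∏ s ∈ D.primeFactors, singularSeriesFactor H s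

/-- `exclProd H D > 0` for admissible `H`. [cite: Maynard2016DenseClusters, §7] -/
theorem exclProd_pos {H : Finset ℤ} (hH : IsAdmissibleTuple H) (D : ℕ) : 0 < exclProd H D :=
  Finset.prod_pos fun s hs =>
    singularSeriesFactor_pos H (Nat.prime_of_mem_primeFactors hs) (hH s (Nat.prime_of_mem_primeFactors hs))

/-- **`singPartial 𝓛_1 D x · ∏_{s ∣ D} f(s) = ∏_{s ≤ x} f(s)`** for `0 < D ≤ x`: the excluded
partial product times the excluded factors is the Hardy–Littlewood partial product.
[cite: Maynard2016DenseClusters, §7 (7.1)] -/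
theorem singPartial_tupleForms_one_mul_exclProd (H : Finset ℤ) {k : ℕ} (hk : H.card = k) {D x : ℕ}
    (hD : D ≠ 0) (hDx : D ≤ x) :
    singPartial (tupleForms (tupleEnum H hk) 1) D x * exclProd H D = singularSeriesPartial H x := by
  unfold singularSeriesPartial exclProd singPartial
  rw [← Finset.prod_filter_mul_prod_filter_not (Nat.primesLE x) (fun s => ¬ s ∣ D)]
  congr 1
  · have hset : (Finset.range (x + 1)).filter (fun p => p.Prime ∧ ¬ p ∣ D) =
        (Nat.primesLE x).filter (fun s => ¬ s ∣ D) := by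
      ext s
      simp only [Finset.mem_filter, Finset.mem_range, Nat.mem_primesLE, Nat.lt_succ_iff, and_assoc]
    rw [hset]
    refine Finset.prod_congr rfl fun s hs => ?_
    rw [Finset.mem_filter, Nat.mem_primesLE] at hs
    exact singFactor_tupleForms_one H hk hs.1.2
  · refine Finset.prod_congr ?_ fun _ _ => rfl
    ext s
    simp only [Nat.mem_primeFactors, Finset.mem_filter, Nat.mem_primesLE, not_not]
    constructor
    · rintro ⟨hs, hsD, -⟩
      exact ⟨⟨(Nat.le_of_dvd (Nat.pos_of_ne_zero hD) hsD).trans hDx, hs⟩, hsD⟩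
    · rintro ⟨⟨-, hs⟩, hsD⟩
      exact ⟨hs, hsD, hD⟩

/-- **Convergence of `𝔖_D(𝓛_1)`**: the excluded partial products converge to `𝔖(H)/∏_{s ∣ D} f(s)`.
[cite: Maynard2016DenseClusters, §7 ("we see the product 𝔖_D(𝓛) converges")] -/
theorem tendsto_singPartial_tupleForms_one {H : Finset ℤ} (hH : IsAdmissibleTuple H) {k : ℕ}
    (hk : H.card = k) {D : ℕ} (hD : D ≠ 0) :
    Tendsto (singPartial (tupleForms (tupleEnum H hk) 1) D) atTop
      (𝓝 (singularSeries H / exclProd H D)) := by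
  have hE := exclProd_pos hH D
  have hev : (fun x => singularSeriesPartial H x / exclProd H D) =ᶠ[atTop]
      singPartial (tupleForms (tupleEnum H hk) 1) D := by
    filter_upwards [eventually_ge_atTop D] with x hx
    rw [← singPartial_tupleForms_one_mul_exclProd H hk hD hx, mul_div_cancel_right₀ _ hE.ne']
  exact ((tendsto_singularSeriesPartial_holds H).div_const _).congr' hev

/-- **`𝔖_D(𝓛_1) = 𝔖(H) / ∏_{s ∣ D} f_H(s)`** (`D ≥ 1`, `H` admissible).
[cite: Maynard2016DenseClusters, §7 (7.1)] -/
theorem singSeriesExcl_tupleForms_one {H : Finset ℤ} (hH : IsAdmissibleTuple H) {k : ℕ}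
    (hk : H.card = k) {D : ℕ} (hD : D ≠ 0) :
    singSeriesExcl (tupleForms (tupleEnum H hk) 1) D = singularSeries H / exclProd H D :=
  (tendsto_singPartial_tupleForms_one hH hk hD).limUnder_eq

/-- `𝔖_D(𝓛_1) > 0` for admissible `H`. [cite: Maynard2016DenseClusters, §7] -/
theorem singSeriesExcl_tupleForms_one_pos {H : Finset ℤ} (hH : IsAdmissibleTuple H) {k : ℕ}
    (hk : H.card = k) {D : ℕ} (hD : D ≠ 0) :
    0 < singSeriesExcl (tupleForms (tupleEnum H hk) 1) D := by
  rw [singSeriesExcl_tupleForms_one hH hk hD]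
  exact div_pos ((singularSeries_pos_iff_holds H).mpr hH) (exclProd_pos hH D)

/-- The local factor of `𝓛_1` at a prime is positive for admissible `H`. [cite: Maynard2016DenseClusters, §7] -/
theorem singFactor_tupleForms_one_pos {H : Finset ℤ} (hH : IsAdmissibleTuple H) {k : ℕ}
    (hk : H.card = k) {s : ℕ} (hs : s.Prime) :
    0 < singFactor (tupleForms (tupleEnum H hk) 1) s := by
  rw [singFactor_tupleForms_one H hk hs]
  exact singularSeriesFactor_pos H hs (hH s hs)

/-- **`𝔖_D(𝓛_p)` as a limit**: for `p` prime, `p ∤ D`, `D ≥ 1`, `H` admissible, the excluded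
partial products of `𝓛_p` converge to `(f_{𝓛_p}(p)/f_{𝓛_1}(p)) · 𝔖_D(𝓛_1)`.
[cite: FordGreenKonyaginMaynardTao2018, §8 proof of (6.3)] -/
theorem tendsto_singPartial_tupleForms {H : Finset ℤ} (hH : IsAdmissibleTuple H) {k : ℕ}
    (hk : H.card = k) {p D : ℕ} (hp : p.Prime) (hpD : ¬ p ∣ D) (hD : D ≠ 0) :
    Tendsto (singPartial (tupleForms (tupleEnum H hk) p) D) atTop
      (𝓝 (singFactor (tupleForms (tupleEnum H hk) p) p / singFactor (tupleForms (tupleEnum H hk) 1) p *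
        (singularSeries H / exclProd H D))) := by
  have hf := singFactor_tupleForms_one_pos hH hk hp
  have hev : (fun x => singFactor (tupleForms (tupleEnum H hk) p) p /
      singFactor (tupleForms (tupleEnum H hk) 1) p * singPartial (tupleForms (tupleEnum H hk) 1) D x) =ᶠ[atTop]
      singPartial (tupleForms (tupleEnum H hk) p) D := by
    filter_upwards [eventually_ge_atTop p] with x hx
    have h := singPartial_tupleForms_mul (tupleEnum H hk) hp hpD hx
    rw [div_mul_eq_mul_div, div_eq_iff hf.ne']
    linear_combination -h
  exact ((tendsto_singPartial_tupleForms_one hH hk hD).const_mul _).congr' hev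

/-- **`𝔖_D(𝓛_p) = (f_{𝓛_p}(p)/f_{𝓛_1}(p)) · 𝔖_D(𝓛_1)`** for `p` prime, `p ∤ D`, `D ≥ 1`, `H`
admissible. [cite: FordGreenKonyaginMaynardTao2018, §8 proof of (6.3)] -/
theorem singSeriesExcl_tupleForms {H : Finset ℤ} (hH : IsAdmissibleTuple H) {k : ℕ}
    (hk : H.card = k) {p D : ℕ} (hp : p.Prime) (hpD : ¬ p ∣ D) (hD : D ≠ 0) :
    singSeriesExcl (tupleForms (tupleEnum H hk) p) D =
      singFactor (tupleForms (tupleEnum H hk) p) p / singFactor (tupleForms (tupleEnum H hk) 1) p *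
        singSeriesExcl (tupleForms (tupleEnum H hk) 1) D := by
  rw [singSeriesExcl_tupleForms_one hH hk hD]
  exact (tendsto_singPartial_tupleForms hH hk hp hpD hD).limUnder_eq

/-- If `p ∣ D` then `𝔖_D(𝓛_p) = 𝔖_D(𝓛_1)` (no convergence needed). [cite: FordGreenKonyaginMaynardTao2018, §8] -/
theorem singSeriesExcl_tupleForms_of_dvd (h : Fin k → ℤ) {p D : ℕ} (hp : p.Prime) (hpD : p ∣ D) :
    singSeriesExcl (tupleForms h p) D = singSeriesExcl (tupleForms h 1) D := by
  unfold singSeriesExcl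
  congr 1
  funext x
  exact singPartial_tupleForms_of_not_mem h hp (Or.inl hpD)

/-- **`𝔖_D(L̃_{q,i₀})` as a limit**: for `q` prime, `q ∤ D`, `D ≥ 1`, `H` admissible.
[cite: FordGreenKonyaginMaynardTao2018, §8 proof of (6.4)] -/
theorem tendsto_singPartial_wbpForms {H : Finset ℤ} (hH : IsAdmissibleTuple H) {k : ℕ}
    (hk : H.card = k) {q D : ℕ} (hq : q.Prime) (i₀ : Fin k) (hqD : ¬ q ∣ D) (hD : D ≠ 0) :
    Tendsto (singPartial (wbpForms (tupleEnum H hk) q i₀) D) atTop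
      (𝓝 (singFactor (wbpForms (tupleEnum H hk) q i₀) q / singFactor (tupleForms (tupleEnum H hk) 1) q *
        (singularSeries H / exclProd H D))) := by
  have hf := singFactor_tupleForms_one_pos hH hk hq
  have hev : (fun x => singFactor (wbpForms (tupleEnum H hk) q i₀) q /
      singFactor (tupleForms (tupleEnum H hk) 1) q * singPartial (tupleForms (tupleEnum H hk) 1) D x) =ᶠ[atTop]
      singPartial (wbpForms (tupleEnum H hk) q i₀) D := by
    filter_upwards [eventually_ge_atTop q] with x hx
    have h := singPartial_wbpForms_mul (tupleEnum H hk) hq i₀ hqD hx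
    rw [div_mul_eq_mul_div, div_eq_iff hf.ne']
    linear_combination -h
  exact ((tendsto_singPartial_tupleForms_one hH hk hD).const_mul _).congr' hev

/-- **`𝔖_D(L̃_{q,i₀}) = (f_{L̃}(q)/f_{𝓛_1}(q)) · 𝔖_D(𝓛_1)`** for `q` prime, `q ∤ D`, `D ≥ 1`, `H`
admissible. [cite: FordGreenKonyaginMaynardTao2018, §8 proof of (6.4)] -/
theorem singSeriesExcl_wbpForms {H : Finset ℤ} (hH : IsAdmissibleTuple H) {k : ℕ}
    (hk : H.card = k) {q D : ℕ} (hq : q.Prime) (i₀ : Fin k) (hqD : ¬ q ∣ D) (hD : D ≠ 0) :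
    singSeriesExcl (wbpForms (tupleEnum H hk) q i₀) D =
      singFactor (wbpForms (tupleEnum H hk) q i₀) q / singFactor (tupleForms (tupleEnum H hk) 1) q *
        singSeriesExcl (tupleForms (tupleEnum H hk) 1) D := by
  rw [singSeriesExcl_tupleForms_one hH hk hD]
  exact (tendsto_singPartial_wbpForms hH hk hq i₀ hqD hD).limUnder_eq

/-! ### The size of the correction factors -/

/-- The correction factor at `p`: if `ω_𝓛(p) = 1` and `ω_{𝓛'}(p) = k` then
`f_𝓛(p)/f_{𝓛'}(p) = (1 − 1/p)/(1 − k/p)`. [cite: FordGreenKonyaginMaynardTao2018, §8] -/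
theorem singFactor_div_singFactor_eq {L L' : Fin k → ℤ × ℤ} {p : ℕ} (hp : p.Prime)
    (h1 : omegaL L p = 1) (hk : omegaL L' p = k) (hkp : k < p) :
    singFactor L p / singFactor L' p = (1 - 1 / (p : ℝ)) / (1 - (k : ℝ) / p) := by
  have hp0 : (0 : ℝ) < p := by exact_mod_cast hp.pos
  have hp1 : (1 : ℝ) < p := by exact_mod_cast hp.one_lt
  have hkp' : (k : ℝ) < p := by exact_mod_cast hkp
  have hA : (1 - 1 / (p : ℝ))⁻¹ ^ k ≠ 0 := by
    apply pow_ne_zero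
    apply inv_ne_zero
    rw [sub_ne_zero, ne_comm, Ne, div_eq_one_iff_eq hp0.ne']
    exact hp1.ne
  have hB : (1 - (k : ℝ) / p) ≠ 0 := by
    rw [sub_ne_zero, ne_comm, Ne, div_eq_one_iff_eq hp0.ne']
    exact hkp'.ne
  simp only [singFactor, h1, hk, Nat.cast_one]
  rw [mul_div_mul_right _ _ hA]

/-- **`1 ≤ (1 − 1/p)/(1 − k/p) ≤ 1 + 2k/p`** for `1 ≤ k` and `2k ≤ p`: the size of §8's
correction factors `𝔖(𝓛_p)/𝔖 = 1 + O(k/p)`. [cite: FordGreenKonyaginMaynardTao2018, §8 proof of (6.3)] -/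
theorem one_le_corr_le {k p : ℕ} (hk : 1 ≤ k) (hkp : 2 * k ≤ p) :
    1 ≤ (1 - 1 / (p : ℝ)) / (1 - (k : ℝ) / p) ∧
      (1 - 1 / (p : ℝ)) / (1 - (k : ℝ) / p) ≤ 1 + 2 * (k : ℝ) / p := by
  have hk' : (1 : ℝ) ≤ k := by exact_mod_cast hk
  have hkp' : 2 * (k : ℝ) ≤ p := by exact_mod_cast hkp
  have hp0 : (0 : ℝ) < p := by linarith
  have hden : 0 < 1 - (k : ℝ) / p := by
    rw [sub_pos, div_lt_one hp0]
    linarith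
  have e1 : (1 - 1 / (p : ℝ)) / (1 - (k : ℝ) / p) = ((p : ℝ) - 1) / ((p : ℝ) - k) := by
    field_simp
  have hpk : (0 : ℝ) < (p : ℝ) - k := by linarith
  rw [e1]
  constructor
  · rw [le_div_iff₀ hpk]
    linarith
  · rw [div_le_iff₀ hpk]
    have : (1 + 2 * (k : ℝ) / p) * ((p : ℝ) - k) = (p : ℝ) + k - 2 * (k : ℝ) ^ 2 / p := by
      field_simp
      ring
    rw [this]
    have h2 : 2 * (k : ℝ) ^ 2 / p ≤ k := by
      rw [div_le_iff₀ hp0]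
      nlinarith
    linarith

end Literature.NumberTheory.Sieve.FGKMT2018
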